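import Summits.CriticalPhenomena.Ising3DConformalLimit.Theorems.SynchronousCouplingRotationJoiningIsotropyRotation
import HarnessLib

/-!
# Route `SynchronousCoupling`, crux `RotationJoining` (stmt-CriticalPhenomena-18763), line `SketchIdeator2`
(reshape 2): stub `stub_tiltGeometry` — the lattice geometry of the tilted cells

Helper file of the line (lead skeleton `Cruxes/RotationJoining/Lines/SketchIdeator2.lean`): proves the registered
stub `stub_tiltGeometry : Sig.stub_tiltGeometry` (`= TiltGeometry` of
`Theorems/SynchronousCouplingRotationJoiningIsotropyDefs.lean`) verbatim. Pure lattice geometry of `A = A3 = 3T`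
(`AᵀA = 9I`): Kozma's map `ψ = ⌊A·/3⌋` is a bijection of `ℤ³` (inverse `psiInv`), `|3ψ − A·|_∞ ≤ 2`, every tilted
cell of the window is the `ψ⁻¹`-image of its axis cell (hence has `n³` points), axis cells are disjoint, the cube
`[⌊L/3⌋, 2⌊L/3⌋)³` sits in the tilted cell `u = 0`, two points of a tilted cell are `< 2n` apart in every
coordinate, and the DECOMPOSITION of a tilted `b`-cell (resp. `3b`-cell) into the fine axis `b'`-cells (resp.
`3b'`-cells) it contains plus a remainder of `≤ 30 b² b'` (resp. `≤ 810 b² b'`) points: an uncovered point `x` has a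
fine cell through it poking out of the tilted cell, so (row `ℓ¹`-norms of `A` are `5`) `ψ x` lies within `2b'`
(resp. `6b'`) of a face of the axis cell, and `ψ` is injective; a slab of thickness `c` of an axis `n`-cell has
`≤ 2 c n²` points. Everything is linear integer arithmetic (`omega`) once the three rows of `A` are written out and
the products `n uᵢ`, `n m` are renamed (adapted from the crux disprover's `Cruxes/RotationJoining/Disproof.lean`,
§2 and §7; the rows `A3_mulVec_*` are the lead's, `Theorems/SynchronousCouplingRotationJoiningIsotropyRotation.lean`).
No definitions, no named facts, no sorry.
-/

namespace Summit.CriticalPhenomena.Ising3DConformalLimit.Cruxes.RotationJoining.RateSplitting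

open Literature.Probability.LatticeModels

namespace TiltGeometry

/-- A universal quantifier over `Fin 3` is a triple conjunction. -/
private theorem forall_fin_three {P : Fin 3 → Prop} : (∀ i, P i) ↔ P 0 ∧ P 1 ∧ P 2 :=
  ⟨fun h => ⟨h 0, h 1, h 2⟩, fun h i => by
    fin_cases i
    exacts [h.1, h.2.1, h.2.2]⟩

/-- An existential quantifier over `Fin 3` is a triple disjunction. -/
private theorem exists_fin_three {P : Fin 3 → Prop} : (∃ i, P i) ↔ P 0 ∨ P 1 ∨ P 2 :=
  ⟨by
    rintro ⟨i, hi⟩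
    fin_cases i
    exacts [Or.inl hi, Or.inr (Or.inl hi), Or.inr (Or.inr hi)],
   fun h => h.elim (fun h => ⟨0, h⟩) fun h => h.elim (fun h => ⟨1, h⟩) fun h => ⟨2, h⟩⟩

/-- `ψ ∘ ψ⁻¹ = id` (conjunct 2 of `TiltGeometry`). -/
theorem psi_psiInv (w : Site 3) : psi (psiInv w) = w := by
  ext i
  fin_cases i <;> simp [psi, psiInv, A3_mulVec_zero, A3_mulVec_one, A3_mulVec_two] <;> omega

/-- `ψ⁻¹ ∘ ψ = id` (conjunct 1 of `TiltGeometry`). -/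
theorem psiInv_psi (x : Site 3) : psiInv (psi x) = x := by
  ext i
  fin_cases i <;> simp [psi, psiInv, A3_mulVec_zero, A3_mulVec_one, A3_mulVec_two] <;> omega

/-- `ψ` is injective (it has the left inverse `ψ⁻¹`). -/
private theorem psi_injective : Function.Injective psi :=
  Function.LeftInverse.injective psiInv_psi

/-- `ψ⁻¹` is injective (it has the left inverse `ψ`). -/
private theorem psiInv_injective : Function.Injective psiInv :=
  Function.LeftInverse.injective psi_psiInv

/-- `ψ` is within sup-distance `< 1` of the rotation `T = A/3`: `|3ψ(x)ᵢ − (Ax)ᵢ| ≤ 2` (conjunct 3). -/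
theorem abs_three_mul_psi_sub_le (x : Site 3) (i : Fin 3) : |3 * psi x i - A3.mulVec x i| ≤ 2 := by
  rw [abs_le]
  fin_cases i <;> simp [psi, A3_mulVec_zero, A3_mulVec_one, A3_mulVec_two] <;> omega

/-- Membership in an axis cell, coordinates written out, with the products `n vᵢ` renamed. -/
theorem mem_axisCell_iff_of_eq {n : ℕ} {v : Fin 3 → ℤ} {x : Site 3} {N T0 T1 T2 : ℤ} (hN : (n : ℤ) = N)
    (h0 : (n : ℤ) * v 0 = T0) (h1 : (n : ℤ) * v 1 = T1) (h2 : (n : ℤ) * v 2 = T2) :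
    x ∈ axisCell n v ↔
      (T0 ≤ x 0 ∧ x 0 < T0 + N) ∧ (T1 ≤ x 1 ∧ x 1 < T1 + N) ∧ (T2 ≤ x 2 ∧ x 2 < T2 + N) := by
  rw [← hN, ← h0, ← h1, ← h2]
  simp only [axisCell, Fintype.mem_piFinset, Finset.mem_Ico, forall_fin_three]

/-- Membership in a tilted cell, the three rows of `A` written out, with the products `n uᵢ`, `n m` renamed
(so that `omega` sees linear terms). -/
theorem mem_tiltCell_iff_of_eq {n m : ℕ} {u : Fin 3 → ℤ} {x : Site 3} {N Q P0 P1 P2 : ℤ} (hN : (n : ℤ) = N)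
    (hQ : (n : ℤ) * m = Q) (h0 : (n : ℤ) * u 0 = P0) (h1 : (n : ℤ) * u 1 = P1) (h2 : (n : ℤ) * u 2 = P2) :
    x ∈ tiltCell n m u ↔
      ((-(2 * Q + 2 * N) ≤ x 0 ∧ x 0 ≤ 2 * Q + 2 * N) ∧ (-(2 * Q + 2 * N) ≤ x 1 ∧ x 1 ≤ 2 * Q + 2 * N) ∧
        (-(2 * Q + 2 * N) ≤ x 2 ∧ x 2 ≤ 2 * Q + 2 * N)) ∧
      (3 * P0 ≤ 2 * x 0 + 2 * x 1 - x 2 ∧ 2 * x 0 + 2 * x 1 - x 2 < 3 * P0 + 3 * N) ∧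
      (3 * P1 ≤ -x 0 + 2 * x 1 + 2 * x 2 ∧ -x 0 + 2 * x 1 + 2 * x 2 < 3 * P1 + 3 * N) ∧
      (3 * P2 ≤ 2 * x 0 - x 1 + 2 * x 2 ∧ 2 * x 0 - x 1 + 2 * x 2 < 3 * P2 + 3 * N) := by
  have hb : 2 * (n : ℤ) * ((m : ℤ) + 1) = 2 * Q + 2 * n := by rw [← hQ]; ring
  have e : ∀ i, 3 * (n : ℤ) * u i = 3 * ((n : ℤ) * u i) := fun i => by ring
  have f : ∀ i, 3 * (n : ℤ) * (u i + 1) = 3 * ((n : ℤ) * u i) + 3 * n := fun i => by ring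
  simp only [tiltCell, Finset.mem_filter, Fintype.mem_piFinset, Finset.mem_Icc, forall_fin_three, A3_mulVec_zero,
    A3_mulVec_one, A3_mulVec_two, hb, e, f]
  rw [h0, h1, h2, hN]

/-- The renamed products inherit the window bound: `|uᵢ| ≤ m` gives `|n uᵢ| ≤ n m`. -/
private theorem abs_mul_le_mul {n m : ℕ} {u : Fin 3 → ℤ} (hu : ∀ i, |u i| ≤ m) (i : Fin 3) :
    -((n : ℤ) * m) ≤ (n : ℤ) * u i ∧ (n : ℤ) * u i ≤ (n : ℤ) * m := by
  have h := abs_le.1 (hu i)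
  have hn : (0 : ℤ) ≤ n := by positivity
  exact ⟨by nlinarith, mul_le_mul_of_nonneg_left h.2 hn⟩

/-- **Membership characterisation** (conjunct 10): on the window, `x ∈ tiltCell n m u ↔ ψ x ∈ axisCell n u`. -/
theorem mem_tiltCell_iff_psi_mem {n m : ℕ} {u : Fin 3 → ℤ} (hu : ∀ i, |u i| ≤ m) (x : Site 3) :
    x ∈ tiltCell n m u ↔ psi x ∈ axisCell n u := by
  have k0 := abs_mul_le_mul (n := n) hu 0
  have k1 := abs_mul_le_mul (n := n) hu 1
  have k2 := abs_mul_le_mul (n := n) hu 2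
  rw [mem_tiltCell_iff_of_eq rfl rfl rfl rfl rfl, mem_axisCell_iff_of_eq rfl rfl rfl rfl]
  simp only [psi, A3_mulVec_zero, A3_mulVec_one, A3_mulVec_two]
  constructor
  · rintro ⟨-, c0, c1, c2⟩; omega
  · rintro ⟨c0, c1, c2⟩; omega

/-- **Tilted cell as an image** (conjunct 4): `tiltCell n m u = ψ⁻¹(axisCell n u)` on the window. -/
theorem tiltCell_eq_image {n m : ℕ} {u : Fin 3 → ℤ} (hu : ∀ i, |u i| ≤ m) :
    tiltCell n m u = (axisCell n u).image psiInv := by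
  ext x
  rw [mem_tiltCell_iff_psi_mem hu, Finset.mem_image]
  constructor
  · exact fun h => ⟨psi x, h, psiInv_psi x⟩
  · rintro ⟨w, hw, rfl⟩
    rwa [psi_psiInv]

/-- An axis cell of side `n` has `n³` points. -/
theorem card_axisCell (n : ℕ) (u : Fin 3 → ℤ) : (axisCell n u).card = n ^ 3 := by
  rw [axisCell, Fintype.card_piFinset]
  simp [Finset.prod_const]

/-- **Cardinality** (conjunct 5): a tilted cell of the window has exactly `n³` points. -/
theorem card_tiltCell {n m : ℕ} {u : Fin 3 → ℤ} (hu : ∀ i, |u i| ≤ m) : (tiltCell n m u).card = n ^ 3 := by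
  rw [tiltCell_eq_image hu, Finset.card_image_of_injective _ psiInv_injective, card_axisCell]

/-- **Disjointness** (conjunct 6): axis cells of one side `n ≥ 1` at distinct indices are disjoint. -/
theorem disjoint_axisCell {n : ℕ} {v w : Fin 3 → ℤ} (hn : 1 ≤ n) (hvw : v ≠ w) :
    Disjoint (axisCell n v) (axisCell n w) := by
  obtain ⟨i, hi⟩ := Function.ne_iff.1 hvw
  rw [Finset.disjoint_left]
  intro x hxv hxw
  simp only [axisCell, Fintype.mem_piFinset, Finset.mem_Ico] at hxv hxw
  obtain ⟨h1, h2⟩ := hxv i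
  obtain ⟨h3, h4⟩ := hxw i
  have hn' : (0 : ℤ) ≤ n := by positivity
  rcases lt_or_gt_of_ne hi with h | h
  · have key : (n : ℤ) * (v i + 1) ≤ n * w i := mul_le_mul_of_nonneg_left (by omega) hn'
    rw [mul_add, mul_one] at key
    omega
  · have key : (n : ℤ) * (w i + 1) ≤ n * v i := mul_le_mul_of_nonneg_left (by omega) hn'
    rw [mul_add, mul_one] at key
    omega

/-- **Sub-cube** (conjunct 7): the axis cube `[s, 2s)³`, `s = ⌊L/3⌋`, lies in the tilted cell `u = 0` of side `L`. -/
theorem axisCell_div_three_subset (L m : ℕ) : axisCell (L / 3) (fun _ => 1) ⊆ tiltCell L m 0 := by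
  intro x hx
  simp only [axisCell, Fintype.mem_piFinset, Finset.mem_Ico, mul_one, forall_fin_three] at hx
  rw [mem_tiltCell_iff_of_eq (N := L) (Q := (L : ℤ) * m) (P0 := 0) (P1 := 0) (P2 := 0) rfl rfl (by simp) (by simp)
    (by simp)]
  have hs : 3 * ((L / 3 : ℕ) : ℤ) ≤ (L : ℤ) := by exact_mod_cast Nat.mul_div_le L 3
  have hQ : (0 : ℤ) ≤ (L : ℤ) * m := by positivity
  omega

/-- **Coordinate diameter** (conjunct 9): two points of one tilted cell differ by `< 2n` in every coordinate
(`AᵀA = 9`, the rows of `Aᵀ` have `ℓ¹`-norm `5`, and `5(3n − 1) < 18n`). -/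
theorem abs_sub_lt_of_mem_tiltCell {n m : ℕ} {u : Fin 3 → ℤ} {x y : Site 3} (hx : x ∈ tiltCell n m u)
    (hy : y ∈ tiltCell n m u) : ∀ i, |x i - y i| < 2 * (n : ℤ) := by
  rw [mem_tiltCell_iff_of_eq rfl rfl rfl rfl rfl] at hx hy
  simp only [forall_fin_three, abs_lt]
  omega

/-! ### The decomposition of a tilted cell into fine axis cells (conjunct 8) -/

/-- Every point lies in the axis cell of side `n ≥ 1` indexed by its coordinatewise quotient. -/
theorem mem_axisCell_ediv {n : ℕ} (hn : 1 ≤ n) (x : Site 3) : x ∈ axisCell n (fun i => x i / (n : ℤ)) := by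
  rw [axisCell, Fintype.mem_piFinset]
  intro i
  rw [Finset.mem_Ico]
  have hn' : (0 : ℤ) < n := by exact_mod_cast hn
  exact ⟨Int.mul_ediv_self_le hn'.ne', Int.lt_mul_ediv_self_add hn'⟩

/-- Arithmetic core, scale `b`, case A: if the fine cell `axisCell b' v ∋ x` contains a point `y` outside
`tiltCell b m u`, then `ψ x` lies within `2b'` of a face of `axisCell b u`. -/
private theorem psi_near_face_A {b b' m : ℕ} {u v : Fin 3 → ℤ} (hu : ∀ i, |u i| ≤ m) {x y : Site 3}
    (hx : x ∈ axisCell b' v) (hy : y ∈ axisCell b' v) (hy' : y ∉ tiltCell b m u) :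
    ∃ i, psi x i < (b : ℤ) * u i + ((2 * b' : ℕ) : ℤ) ∨ (b : ℤ) * u i + b - ((2 * b' : ℕ) : ℤ) ≤ psi x i := by
  obtain ⟨P, hP⟩ : ∃ P : Fin 3 → ℤ, ∀ i, (b : ℤ) * u i = P i := ⟨_, fun _ => rfl⟩
  obtain ⟨T, hT⟩ : ∃ T : Fin 3 → ℤ, ∀ i, (b' : ℤ) * v i = T i := ⟨_, fun _ => rfl⟩
  rw [mem_axisCell_iff_of_eq rfl (hT 0) (hT 1) (hT 2)] at hx hy
  rw [mem_tiltCell_iff_psi_mem hu, mem_axisCell_iff_of_eq rfl (hP 0) (hP 1) (hP 2)] at hy'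
  simp only [psi, A3_mulVec_zero, A3_mulVec_one, A3_mulVec_two, exists_fin_three, hP] at hy' ⊢
  push_cast
  omega

/-- Arithmetic core, scale `b`, case B: if the cell `axisCell (3b') v` (with `x ∈ axisCell b' v`) contains a
point `y` outside `tiltCell (3b) m u`, then `ψ x` lies within `2b'` of a face of `axisCell b u`. -/
private theorem psi_near_face_B {b b' m : ℕ} {u v : Fin 3 → ℤ} (hu : ∀ i, |u i| ≤ m) {x y : Site 3}
    (hx : x ∈ axisCell b' v) (hy : y ∈ axisCell (3 * b') v) (hy' : y ∉ tiltCell (3 * b) m u) :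
    ∃ i, psi x i < (b : ℤ) * u i + ((2 * b' : ℕ) : ℤ) ∨ (b : ℤ) * u i + b - ((2 * b' : ℕ) : ℤ) ≤ psi x i := by
  obtain ⟨P, hP⟩ : ∃ P : Fin 3 → ℤ, ∀ i, (b : ℤ) * u i = P i := ⟨_, fun _ => rfl⟩
  obtain ⟨T, hT⟩ : ∃ T : Fin 3 → ℤ, ∀ i, (b' : ℤ) * v i = T i := ⟨_, fun _ => rfl⟩
  have hP3 : ∀ i, ((3 * b : ℕ) : ℤ) * u i = 3 * P i := fun i => by push_cast; rw [mul_assoc, hP i]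
  have hT3 : ∀ i, ((3 * b' : ℕ) : ℤ) * v i = 3 * T i := fun i => by push_cast; rw [mul_assoc, hT i]
  rw [mem_axisCell_iff_of_eq rfl (hT 0) (hT 1) (hT 2)] at hx
  rw [mem_axisCell_iff_of_eq (by push_cast; rfl) (hT3 0) (hT3 1) (hT3 2)] at hy
  rw [mem_tiltCell_iff_psi_mem hu, mem_axisCell_iff_of_eq (by push_cast; rfl) (hP3 0) (hP3 1) (hP3 2)] at hy'
  simp only [psi, A3_mulVec_zero, A3_mulVec_one, A3_mulVec_two, exists_fin_three, hP] at hy' ⊢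
  push_cast
  omega

/-- Arithmetic core, scale `3b`, case A: if `x ∈ axisCell (3b') v` and the cell `axisCell b' v` contains a point
`y` outside `tiltCell b m u`, then `ψ x` lies within `6b'` of a face of `axisCell (3b) u`. -/
private theorem psi_near_face_A3 {b b' m : ℕ} {u v : Fin 3 → ℤ} (hu : ∀ i, |u i| ≤ m) {x y : Site 3}
    (hx : x ∈ axisCell (3 * b') v) (hy : y ∈ axisCell b' v) (hy' : y ∉ tiltCell b m u) :
    ∃ i, psi x i < ((3 * b : ℕ) : ℤ) * u i + ((6 * b' : ℕ) : ℤ) ∨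
      ((3 * b : ℕ) : ℤ) * u i + ((3 * b : ℕ) : ℤ) - ((6 * b' : ℕ) : ℤ) ≤ psi x i := by
  obtain ⟨P, hP⟩ : ∃ P : Fin 3 → ℤ, ∀ i, (b : ℤ) * u i = P i := ⟨_, fun _ => rfl⟩
  obtain ⟨T, hT⟩ : ∃ T : Fin 3 → ℤ, ∀ i, (b' : ℤ) * v i = T i := ⟨_, fun _ => rfl⟩
  have hP3 : ∀ i, ((3 * b : ℕ) : ℤ) * u i = 3 * P i := fun i => by push_cast; rw [mul_assoc, hP i]
  have hT3 : ∀ i, ((3 * b' : ℕ) : ℤ) * v i = 3 * T i := fun i => by push_cast; rw [mul_assoc, hT i]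
  rw [mem_axisCell_iff_of_eq (by push_cast; rfl) (hT3 0) (hT3 1) (hT3 2)] at hx
  rw [mem_axisCell_iff_of_eq rfl (hT 0) (hT 1) (hT 2)] at hy
  rw [mem_tiltCell_iff_psi_mem hu, mem_axisCell_iff_of_eq rfl (hP 0) (hP 1) (hP 2)] at hy'
  simp only [psi, A3_mulVec_zero, A3_mulVec_one, A3_mulVec_two, exists_fin_three, hP3] at hy' ⊢
  push_cast
  omega

/-- Arithmetic core, scale `3b`, case B (case A one scale up): if the cell `axisCell (3b') v ∋ x` contains a point
`y` outside `tiltCell (3b) m u`, then `ψ x` lies within `6b'` of a face of `axisCell (3b) u`. -/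
private theorem psi_near_face_B3 {b b' m : ℕ} {u v : Fin 3 → ℤ} (hu : ∀ i, |u i| ≤ m) {x y : Site 3}
    (hx : x ∈ axisCell (3 * b') v) (hy : y ∈ axisCell (3 * b') v) (hy' : y ∉ tiltCell (3 * b) m u) :
    ∃ i, psi x i < ((3 * b : ℕ) : ℤ) * u i + ((6 * b' : ℕ) : ℤ) ∨
      ((3 * b : ℕ) : ℤ) * u i + ((3 * b : ℕ) : ℤ) - ((6 * b' : ℕ) : ℤ) ≤ psi x i := by
  simpa only [show 2 * (3 * b') = 6 * b' by ring] using psi_near_face_A hu hx hy hy'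

/-- Counting a slab: the points of `axisCell n u` within `c` of one of the two faces normal to `i` number
at most `2 c n²`. -/
private theorem card_filter_near_face_le (n c : ℕ) (u : Fin 3 → ℤ) (i : Fin 3) :
    ((axisCell n u).filter fun w => w i < (n : ℤ) * u i + c ∨ (n : ℤ) * u i + n - c ≤ w i).card ≤
      2 * c * n ^ 2 := by
  classical
  set s : Fin 3 → Finset ℤ := fun j => Finset.Ico ((n : ℤ) * u j) ((n : ℤ) * u j + n) with hs_def
  set t : Finset ℤ := Finset.Ico ((n : ℤ) * u i) ((n : ℤ) * u i + c) ∪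
    Finset.Ico ((n : ℤ) * u i + n - c) ((n : ℤ) * u i + n) with ht_def
  have hsub : ((axisCell n u).filter fun w => w i < (n : ℤ) * u i + c ∨ (n : ℤ) * u i + n - c ≤ w i) ⊆
      Fintype.piFinset (Function.update s i t) := by
    intro w hw
    rw [Finset.mem_filter, axisCell, Fintype.mem_piFinset] at hw
    rw [Fintype.mem_piFinset]
    intro j
    by_cases hji : j = i
    · subst hji
      rw [Function.update_self, ht_def, Finset.mem_union, Finset.mem_Ico, Finset.mem_Ico]
      have h := hw.1 j
      rw [Finset.mem_Ico] at h
      omega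
    · rw [Function.update_of_ne hji]
      exact hw.1 j
  have hs : ∀ j, (s j).card = n := fun j => by simp [hs_def]
  have ht : t.card ≤ 2 * c := by
    refine (Finset.card_union_le _ _).trans ?_
    simp only [Int.card_Ico]
    omega
  calc _ ≤ (Fintype.piFinset (Function.update s i t)).card := Finset.card_le_card hsub
    _ = t.card * n ^ 2 := by
        rw [Fintype.card_piFinset, Fin.prod_univ_succAbove _ i]
        simp [hs]
    _ ≤ 2 * c * n ^ 2 := Nat.mul_le_mul_right _ ht

/-- Counting the union of the six slabs: at most `6 c n²` points of `axisCell n u` lie within `c` of a face. -/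
private theorem card_near_faces_le (n c : ℕ) (u : Fin 3 → ℤ) :
    (Finset.univ.biUnion fun i : Fin 3 =>
        (axisCell n u).filter fun w => w i < (n : ℤ) * u i + c ∨ (n : ℤ) * u i + n - c ≤ w i).card ≤
      6 * c * n ^ 2 := by
  refine Finset.card_biUnion_le.trans ?_
  calc ∑ i : Fin 3, ((axisCell n u).filter fun w => w i < (n : ℤ) * u i + c ∨ (n : ℤ) * u i + n - c ≤ w i).card
      ≤ ∑ _i : Fin 3, 2 * c * n ^ 2 := Finset.sum_le_sum fun i _ => card_filter_near_face_le n c u i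
    _ = 6 * c * n ^ 2 := by simp; ring

/-- **Remainder bound.** If every point `x` of `tiltCell n m u` whose fine index `⌊x/k⌋` is NOT in `I` has `ψ x`
within `c` of a face of `axisCell n u`, then the part of the tilted cell not covered by the axis `k`-cells indexed
by `I` has at most `6 c n²` points (`ψ` is injective and maps the tilted cell into the axis cell). -/
theorem card_sdiff_biUnion_le {n k c m : ℕ} {u : Fin 3 → ℤ} (hk : 1 ≤ k) (hu : ∀ i, |u i| ≤ m)
    (I : Finset (Fin 3 → ℤ))
    (hkey : ∀ x ∈ tiltCell n m u, (fun i => x i / (k : ℤ)) ∉ I →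
      ∃ i, psi x i < (n : ℤ) * u i + c ∨ (n : ℤ) * u i + n - c ≤ psi x i) :
    (tiltCell n m u \ I.biUnion (axisCell k)).card ≤ 6 * c * n ^ 2 := by
  classical
  rw [← Finset.card_image_of_injective _ psi_injective]
  refine (Finset.card_le_card (Finset.image_subset_iff.2 fun x hx => ?_)).trans (card_near_faces_le n c u)
  rw [Finset.mem_sdiff] at hx
  obtain ⟨i, hi⟩ := hkey x hx.1 fun h => hx.2 (Finset.mem_biUnion.2 ⟨_, h, mem_axisCell_ediv hk x⟩)
  simp only [Finset.mem_biUnion, Finset.mem_univ, true_and, Finset.mem_filter]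
  exact ⟨i, (mem_tiltCell_iff_psi_mem hu x).1 hx.1, hi⟩

/-- Indices of fitting fine cells lie in the window `|vᵢ| ≤ 2b(m+1)` (the corner `b' v` lies in the box). -/
private theorem abs_le_of_axisCell_subset {b b' m : ℕ} {u v : Fin 3 → ℤ} (hb' : 1 ≤ b')
    (h : axisCell b' v ⊆ tiltCell b m u) (i : Fin 3) : |v i| ≤ 2 * (b : ℤ) * ((m : ℤ) + 1) := by
  have hc : (fun j => (b' : ℤ) * v j) ∈ axisCell b' v := by
    rw [axisCell, Fintype.mem_piFinset]
    intro j
    rw [Finset.mem_Ico]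
    constructor <;> omega
  have hbox := (Finset.mem_filter.1 (h hc)).1
  rw [Fintype.mem_piFinset] at hbox
  have hi := abs_le.2 (Finset.mem_Icc.1 (hbox i))
  rw [abs_mul, Nat.abs_cast] at hi
  exact (le_mul_of_one_le_left (abs_nonneg _) (by exact_mod_cast hb')).trans hi

/-- **Decomposition** (conjunct 8): `I` = the fine indices `v` (among the quotients `⌊x/b'⌋`, `x ∈ tiltCell b m u`,
and `⌊x/(3b')⌋`, `x ∈ tiltCell (3b) m u`) whose axis `b'`-cell fits in `tiltCell b m u` and whose axis `3b'`-cell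
fits in `tiltCell (3b) m u`; the remainders are counted by `card_sdiff_biUnion_le` (`12 b² b' ≤ 30 b² b'`,
`324 b² b' ≤ 810 b² b'`), and `|I| b'³ ≤ b³` because the fitting `b'`-cells are disjoint inside a set of `b³` points.
(The hypothesis `3b' ≤ b` is not needed.) -/
theorem tiltCell_decomposition (b b' m : ℕ) (u : Fin 3 → ℤ) (hb' : 1 ≤ b') (_hb : 3 * b' ≤ b)
    (hu : ∀ i, |u i| ≤ m) :
    ∃ I : Finset (Fin 3 → ℤ),
      (∀ v ∈ I, ∀ i, |v i| ≤ 2 * (b : ℤ) * ((m : ℤ) + 1)) ∧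
      (∀ v ∈ I, axisCell b' v ⊆ tiltCell b m u) ∧
      (∀ v ∈ I, axisCell (3 * b') v ⊆ tiltCell (3 * b) m u) ∧
      ((tiltCell b m u \ I.biUnion (axisCell b')).card ≤ 30 * b ^ 2 * b') ∧
      ((tiltCell (3 * b) m u \ I.biUnion (axisCell (3 * b'))).card ≤ 810 * b ^ 2 * b') ∧
      ((I.card : ℝ) * (b' : ℝ) ^ 3 ≤ (b : ℝ) ^ 3) := by
  classical
  set F : Finset (Fin 3 → ℤ) := (tiltCell b m u).image (fun x i => x i / (b' : ℤ)) ∪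
    (tiltCell (3 * b) m u).image (fun x i => x i / ((3 * b' : ℕ) : ℤ))
  set I : Finset (Fin 3 → ℤ) :=
    F.filter (fun v => axisCell b' v ⊆ tiltCell b m u ∧ axisCell (3 * b') v ⊆ tiltCell (3 * b) m u)
  have hI : ∀ v, v ∈ I ↔ v ∈ F ∧ (axisCell b' v ⊆ tiltCell b m u ∧ axisCell (3 * b') v ⊆ tiltCell (3 * b) m u) :=
    fun v => Finset.mem_filter
  refine ⟨I, fun v hv => abs_le_of_axisCell_subset hb' ((hI v).1 hv).2.1, fun v hv => ((hI v).1 hv).2.1,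
    fun v hv => ((hI v).1 hv).2.2, ?_, ?_, ?_⟩
  · refine (card_sdiff_biUnion_le (c := 2 * b') hb' hu I fun x hx hxI => ?_).trans ?_
    · have hxv := mem_axisCell_ediv hb' x
      by_cases h1 : axisCell b' (fun i => x i / (b' : ℤ)) ⊆ tiltCell b m u
      · by_cases h2 : axisCell (3 * b') (fun i => x i / (b' : ℤ)) ⊆ tiltCell (3 * b) m u
        · exact absurd ((hI _).2 ⟨Finset.mem_union_left _ (Finset.mem_image_of_mem _ hx), h1, h2⟩) hxI
        · obtain ⟨y, hy, hy'⟩ := Finset.not_subset.1 h2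
          exact psi_near_face_B hu hxv hy hy'
      · obtain ⟨y, hy, hy'⟩ := Finset.not_subset.1 h1
        exact psi_near_face_A hu hxv hy hy'
    · have e : 6 * (2 * b') * b ^ 2 = 12 * (b ^ 2 * b') := by ring
      rw [e, mul_assoc]
      omega
  · refine (card_sdiff_biUnion_le (c := 6 * b') (k := 3 * b') (by omega) hu I fun x hx hxI => ?_).trans ?_
    · have hxv := mem_axisCell_ediv (n := 3 * b') (by omega) x
      by_cases h1 : axisCell b' (fun i => x i / ((3 * b' : ℕ) : ℤ)) ⊆ tiltCell b m u
      · by_cases h2 : axisCell (3 * b') (fun i => x i / ((3 * b' : ℕ) : ℤ)) ⊆ tiltCell (3 * b) m u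
        · exact absurd ((hI _).2 ⟨Finset.mem_union_right _ (Finset.mem_image_of_mem _ hx), h1, h2⟩) hxI
        · obtain ⟨y, hy, hy'⟩ := Finset.not_subset.1 h2
          exact psi_near_face_B3 hu hxv hy hy'
      · obtain ⟨y, hy, hy'⟩ := Finset.not_subset.1 h1
        exact psi_near_face_A3 hu hxv hy hy'
    · have e : 6 * (6 * b') * (3 * b) ^ 2 = 324 * (b ^ 2 * b') := by ring
      rw [e, mul_assoc]
      omega
  · have hdisj : (I : Set (Fin 3 → ℤ)).PairwiseDisjoint (axisCell b') :=
      fun v _ w _ hvw => disjoint_axisCell hb' hvw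
    have hsub : I.biUnion (axisCell b') ⊆ tiltCell b m u :=
      Finset.biUnion_subset.2 fun v hv => ((hI v).1 hv).2.1
    have key := Finset.card_le_card hsub
    rw [Finset.card_biUnion hdisj, card_tiltCell hu] at key
    simp only [card_axisCell, Finset.sum_const, smul_eq_mul] at key
    exact_mod_cast key

end TiltGeometry

open TiltGeometry in
/-- **Stub `stub_tiltGeometry`** (= `TiltGeometry`): Kozma's bijection `ψ = ⌊A·/3⌋` and its inverse, the bound
`|3ψ − A·|_∞ ≤ 2`, tilted cells as `ψ⁻¹`-images of axis cells (card `n³`), disjointness of axis cells, the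
sub-cube `[⌊L/3⌋, 2⌊L/3⌋)³ ⊆ tiltCell L m 0`, the decomposition of a tilted cell into fine axis cells with boundary
remainders `≤ 30 b² b'` / `≤ 810 b² b'`, the coordinate diameter `< 2n`, and the membership characterisation. -/
theorem stub_tiltGeometry : Sig.stub_tiltGeometry :=
  ⟨psiInv_psi, psi_psiInv, abs_three_mul_psi_sub_le, fun _ _ _ hu => tiltCell_eq_image hu,
    fun _ _ _ hu => card_tiltCell hu, fun _ _ _ hn hvw => disjoint_axisCell hn hvw, axisCell_div_three_subset,
    tiltCell_decomposition, fun _ _ _ _ _ hx hy => abs_sub_lt_of_mem_tiltCell hx hy,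
    fun _ _ _ hu => mem_tiltCell_iff_psi_mem hu⟩

end Summit.CriticalPhenomena.Ising3DConformalLimit.Cruxes.RotationJoining.RateSplitting
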